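import Summits.NavierStokesRegularity.NavierStokesRegularity.Theorems.FilamentSkeletonRssCoreLinearInvertibilityArnoldModeSplitToolsD

/-!
# Crux `CoreLinearInvertibility` (stmt-NavierStokesRegularity-17973), line `Sketch`, stub `stub_arnoldModeSplit`:
# splitting an odd Gaussian-class density into its `k = ±1` angular part and the rest

For a continuous, odd, Gaussian-class density `ω` on `ℝ²` with vanishing first moments, with
`a(r) = π⁻¹∫ ω(circlePt r θ) cos θ dθ`, `b(r) = π⁻¹ ∫ ω(circlePt r θ) sin θ dθ`,
`ω₁(x) = (a(|x|)x₀ + b(|x|)x₁)/|x|` and `ω_r = ω − ω₁` (parts A–D of the tools), this file proves the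
registered stub `stub_arnoldModeSplit` of the wave-3 interface of line `Sketch` (discharge of
`GallaySverak2021_thm25_gaussian`): continuity / Gaussian class / oddness of `a`, `b`, `ω_r`, the vanishing
of the `k = ±1` circle coefficients of `ω_r`, the moment constraints `∫ r² a = ∫ r² b = 0`, the orthogonality
`∫ Φ⁻¹ ω² = π ∫ Φ⁻¹ (a² + b²) r dr + ∫ Φ⁻¹ ω_r²`, and the **per-mode potential formula**

  `∫ ω ψ_ω = −π ∫₀^∞ ((B₁a) a + (B₁b) b) r dr + ∫ ω_r ψ_{ω_r}`,  `(B₁c)(r) = ½ ∫₀^∞ min(r/s, s/r) c(s) s ds`,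

`ψ_f = (2π)⁻¹ log|·| ∗ f`.  Proof of the last identity (no Fourier series, no derivative of `ψ`):
`ω ψ_ω − ω_r ψ_{ω_r} = ω₁ ψ_ω + ω_r ψ_{ω₁}` pointwise (linearity of `ψ`); by polar coordinates and the
`k = ±1` circle coefficients of `ψ_f` (part D: `∫ ψ_f(circlePt r θ) cos θ dθ = −π (B₁a_f)(r)`),
`∫ ω₁ ψ_f = −π ∫ ((B₁a_f) a + (B₁b_f) b) r dr` for every Gaussian-class `f`; with `f = ω` this is the main
term, and `∫ ω_r ψ_{ω₁} = ∫ ω₁ ψ_{ω_r} = 0` by the symmetry of the energy form and `a_{ω_r} = b_{ω_r} = 0`.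

Reference: Th. Gallay, V. Šverák, *Arnold's variational principle and its application to the stability of
planar vortices*, arXiv:2110.13739 (Analysis & PDE 17 (2024)), §3, proof of Thm. 2.5 ((Jk), (Bkdef) with
`k = 1`). Everything here is folklore calculus.
-/

set_option linter.dupNamespace false

noncomputable section

namespace Summit.NavierStokesRegularity.NavierStokesRegularity.Theorems

open Set Function Filter MeasureTheory Topology Metric
open Literature.Analysis.FluidPDE
open Summit.AnomalousDissipation.AnomalousDissipation.Theorems.MarginalStabilityChainStretchedVortexRows
open scoped Real InnerProductSpace

section Energy

variable {om : EuclideanSpace ℝ (Fin 2) → ℝ} {a b : ℝ → ℝ} {om₁ omr : EuclideanSpace ℝ (Fin 2) → ℝ}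

/-- **`∫ ω₁ ψ_f = −π ∫₀^∞ ((B₁a_f) a + (B₁b_f) b) r dr`** for the `k = ±1` part `ω₁` (continuous `a`, `b`
vanishing at `0`, `ω₁` Gaussian-bounded) and any continuous Gaussian-bounded `f`
(`a_f`, `b_f` the circle coefficients of `f`, `(B₁c)(r) = ½∫₀^∞ min(r/s,s/r) c(s) s ds`): polar
coordinates, `ω₁(circlePt r θ) = a(r) cos θ + b(r) sin θ`, and the circle coefficients of `ψ_f`. [folklore] -/
theorem modeSplit_integral_om₁_mul_logPotential (hac : Continuous a) (hbc : Continuous b)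
    (ha0 : a 0 = 0) (hb0 : b 0 = 0) (hom₁ : ∀ x, om₁ x = (a ‖x‖ * x 0 + b ‖x‖ * x 1) / ‖x‖)
    {B₁ : ℝ} (hB₁ : ∀ x, |om₁ x| ≤ B₁ * Real.exp (-(1 / 8) * ‖x‖ ^ 2))
    {f : EuclideanSpace ℝ (Fin 2) → ℝ} (hf : Continuous f) {B : ℝ} (hB : ∀ y, |f y| ≤ B * Real.exp (-(1 / 8) * ‖y‖ ^ 2))
    {af bf : ℝ → ℝ}
    (haf : ∀ s, af s = (1 / Real.pi) * ∫ φ in (-Real.pi)..Real.pi, f (circlePt s φ) * Real.cos φ)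
    (hbf : ∀ s, bf s = (1 / Real.pi) * ∫ φ in (-Real.pi)..Real.pi, f (circlePt s φ) * Real.sin φ) :
    ∫ x, om₁ x * ∫ y, (2 * Real.pi)⁻¹ * Real.log ‖x - y‖ * f y =
      -(Real.pi * ∫ r in Set.Ioi (0 : ℝ),
          (((1 / 2 : ℝ) * ∫ s in Set.Ioi (0 : ℝ), min (r / s) (s / r) * af s * s) * a r +
            ((1 / 2 : ℝ) * ∫ s in Set.Ioi (0 : ℝ), min (r / s) (s / r) * bf s * s) * b r) * r) := by
  have hπ : -π ≤ π := by linarith [Real.pi_pos]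
  have hom₁c : Continuous om₁ := modeSplit_continuous_om₁ hac hbc ha0 hb0 hom₁
  have hint : Integrable fun x => om₁ x * ∫ y, (2 * Real.pi)⁻¹ * Real.log ‖x - y‖ * f y :=
    modeSplit_integrable_mul_logPotential hf hom₁c hB hB₁
  rw [integral_eq_integral_circlePt hint, ← integral_const_mul, ← integral_neg]
  refine setIntegral_congr_fun measurableSet_Ioi fun r hr => ?_
  have hr : 0 < r := hr
  have hIw : ∀ {w : ℝ → ℝ}, Continuous w → (∀ θ, |w θ| ≤ 1) →
      IntegrableOn (fun θ => (∫ y, (2 * Real.pi)⁻¹ * Real.log ‖circlePt r θ - y‖ * f y) * w θ)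
        (Ioc (-π) π) := by
    intro w hw hw1
    refine ((modeSplit_integrable_circle_logKernel hf hB r hw hw1).integral_prod_left).congr
      (Eventually.of_forall fun θ => ?_)
    simp only [uncurry_apply_pair]
    rw [integral_const_mul, mul_comm]
  have key : ∀ θ : ℝ, r • (om₁ (circlePt r θ) *
      ∫ y, (2 * Real.pi)⁻¹ * Real.log ‖circlePt r θ - y‖ * f y) =
      r * (a r * ((∫ y, (2 * Real.pi)⁻¹ * Real.log ‖circlePt r θ - y‖ * f y) * Real.cos θ) +
        b r * ((∫ y, (2 * Real.pi)⁻¹ * Real.log ‖circlePt r θ - y‖ * f y) * Real.sin θ)) := by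
    intro θ
    rw [modeSplit_om₁_circlePt hom₁ hr, smul_eq_mul]
    ring
  simp_rw [key]
  have i1 := (hIw Real.continuous_cos Real.abs_cos_le_one).const_mul (a r)
  have i2 := (hIw Real.continuous_sin Real.abs_sin_le_one).const_mul (b r)
  rw [integral_const_mul, integral_add i1 i2, integral_const_mul, integral_const_mul,
    ← intervalIntegral.integral_of_le hπ, ← intervalIntegral.integral_of_le hπ,
    modeSplit_circle_logPotential_cos hf hB hr haf, modeSplit_circle_logPotential_sin hf hB hr hbf]
  ring

/-- **The per-mode potential formula** `∫ ω ψ_ω = −π ∫₀^∞ ((B₁a) a + (B₁b) b) r dr + ∫ ω_r ψ_{ω_r}`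
(`ω ψ_ω − ω_r ψ_{ω_r} = ω₁ ψ_ω + ω_r ψ_{ω₁}`; `∫ ω₁ ψ_ω` is the main term; `∫ ω_r ψ_{ω₁} = ∫ ω₁ ψ_{ω_r} = 0`
since the circle coefficients of `ω_r` vanish). [folklore] -/
theorem modeSplit_energy_split (hom : Continuous om)
    (hgc : ∃ (C : ℝ) (N : ℕ), ∀ x, |om x| ≤ C * (1 + ‖x‖) ^ N * Real.exp (-(‖x‖ ^ 2 / 4)))
    (ha : ∀ r, a r = (1 / Real.pi) * ∫ θ in (-Real.pi)..Real.pi, om (circlePt r θ) * Real.cos θ)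
    (hb : ∀ r, b r = (1 / Real.pi) * ∫ θ in (-Real.pi)..Real.pi, om (circlePt r θ) * Real.sin θ)
    (hom₁ : ∀ x, om₁ x = (a ‖x‖ * x 0 + b ‖x‖ * x 1) / ‖x‖) (homr : ∀ x, omr x = om x - om₁ x) :
    ∫ x, om x * ∫ y, (2 * Real.pi)⁻¹ * Real.log ‖x - y‖ * om y =
      -(Real.pi * ∫ r in Set.Ioi (0 : ℝ),
          (((1 / 2 : ℝ) * ∫ s in Set.Ioi (0 : ℝ), min (r / s) (s / r) * a s * s) * a r +
            ((1 / 2 : ℝ) * ∫ s in Set.Ioi (0 : ℝ), min (r / s) (s / r) * b s * s) * b r) * r) +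
        ∫ x, omr x * ∫ y, (2 * Real.pi)⁻¹ * Real.log ‖x - y‖ * omr y := by
  obtain ⟨C, N, hC⟩ := hgc
  have hac : Continuous a := modeSplit_continuous_coeff hom Real.continuous_cos ha
  have hbc : Continuous b := modeSplit_continuous_coeff hom Real.continuous_sin hb
  have ha0 : a 0 = 0 := modeSplit_coeff_zero modeSplit_integral_cos ha
  have hb0 : b 0 = 0 := modeSplit_coeff_zero modeSplit_integral_sin hb
  have hom₁c : Continuous om₁ := modeSplit_continuous_om₁ hac hbc ha0 hb0 hom₁
  have homrc : Continuous omr := modeSplit_continuous_omr hom hom₁c homr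
  obtain ⟨Bo, -, hBo⟩ := arnold_gc_exp_eighth ⟨C, N, hC⟩
  obtain ⟨B₁, -, hB₁⟩ := arnold_gc_exp_eighth ⟨4 * C, N, modeSplit_om₁_gaussClass hC ha hb hom₁⟩
  obtain ⟨Br, -, hBr⟩ := arnold_gc_exp_eighth ⟨5 * C, N, modeSplit_omr_gaussClass hC ha hb hom₁ homr⟩
  -- linearity of the potential
  have hlin : ∀ x : EuclideanSpace ℝ (Fin 2), (∫ y, (2 * Real.pi)⁻¹ * Real.log ‖x - y‖ * om y) =
      (∫ y, (2 * Real.pi)⁻¹ * Real.log ‖x - y‖ * om₁ y) +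
        ∫ y, (2 * Real.pi)⁻¹ * Real.log ‖x - y‖ * omr y := by
    intro x
    rw [← arnold_logPotential_add (modeSplit_integrable_logKernel_mul hom₁c hB₁ x)
      (modeSplit_integrable_logKernel_mul homrc hBr x)]
    exact integral_congr_ae (Eventually.of_forall fun y => by dsimp only; rw [homr]; ring)
  have hpt : ∀ x : EuclideanSpace ℝ (Fin 2), om x * (∫ y, (2 * Real.pi)⁻¹ * Real.log ‖x - y‖ * om y) -
      omr x * (∫ y, (2 * Real.pi)⁻¹ * Real.log ‖x - y‖ * omr y) =
      om₁ x * (∫ y, (2 * Real.pi)⁻¹ * Real.log ‖x - y‖ * om y) +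
        omr x * ∫ y, (2 * Real.pi)⁻¹ * Real.log ‖x - y‖ * om₁ y := by
    intro x
    have e1 : om x = om₁ x + omr x := by rw [homr]; ring
    rw [hlin x, e1]
    ring
  have i1 := modeSplit_integrable_mul_logPotential hom hom hBo hBo
  have i2 := modeSplit_integrable_mul_logPotential homrc homrc hBr hBr
  have i3 := modeSplit_integrable_mul_logPotential hom hom₁c hBo hB₁
  have i4 := modeSplit_integrable_mul_logPotential hom₁c homrc hB₁ hBr
  have hI : (∫ x, om x * ∫ y, (2 * Real.pi)⁻¹ * Real.log ‖x - y‖ * om y) -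
      (∫ x, omr x * ∫ y, (2 * Real.pi)⁻¹ * Real.log ‖x - y‖ * omr y) =
      (∫ x, om₁ x * ∫ y, (2 * Real.pi)⁻¹ * Real.log ‖x - y‖ * om y) +
        ∫ x, omr x * ∫ y, (2 * Real.pi)⁻¹ * Real.log ‖x - y‖ * om₁ y := by
    rw [← integral_sub i1 i2, ← integral_add i3 i4]
    exact integral_congr_ae (Eventually.of_forall hpt)
  -- the cross term vanishes
  have hsym := modeSplit_integral_mul_logPotential_comm hom₁c homrc hB₁ hBr
  have hzero : ∫ y, om₁ y * ∫ x, (2 * Real.pi)⁻¹ * Real.log ‖y - x‖ * omr x = 0 := by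
    rw [modeSplit_integral_om₁_mul_logPotential hac hbc ha0 hb0 hom₁ hB₁ homrc hBr
      (af := fun s => (1 / Real.pi) * ∫ φ in (-Real.pi)..Real.pi, omr (circlePt s φ) * Real.cos φ)
      (bf := fun s => (1 / Real.pi) * ∫ φ in (-Real.pi)..Real.pi, omr (circlePt s φ) * Real.sin φ)
      (fun s => rfl) (fun s => rfl)]
    have hA : ∀ r : ℝ, ∫ s in Set.Ioi (0 : ℝ), min (r / s) (s / r) *
        ((1 / Real.pi) * ∫ φ in (-Real.pi)..Real.pi, omr (circlePt s φ) * Real.cos φ) * s = 0 :=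
      fun r => setIntegral_eq_zero_of_forall_eq_zero fun s hs => by
        rw [modeSplit_omr_circle_cos hom ha hom₁ homr hs]; ring
    have hB : ∀ r : ℝ, ∫ s in Set.Ioi (0 : ℝ), min (r / s) (s / r) *
        ((1 / Real.pi) * ∫ φ in (-Real.pi)..Real.pi, omr (circlePt s φ) * Real.sin φ) * s = 0 :=
      fun r => setIntegral_eq_zero_of_forall_eq_zero fun s hs => by
        rw [modeSplit_omr_circle_sin hom hb hom₁ homr hs]; ring
    simp_rw [hA, hB]
    simp
  rw [hsym, hzero, add_zero, modeSplit_integral_om₁_mul_logPotential hac hbc ha0 hb0 hom₁ hB₁ hom hBo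
    ha hb] at hI
  linarith

end Energy

/-! ### The registered stub -/

/-- (A2) **Registered stub `stub_arnoldModeSplit`** (crux `CoreLinearInvertibility`, line `Sketch`,
stmt-NavierStokesRegularity-17973): splitting an odd Gaussian-class density into its `k = ±1` angular part
`ω₁ = (a(|x|) x₀ + b(|x|) x₁)/|x|` and the rest `ω_r`: regularity and Gaussian class of `a`, `b`, `ω_r`,
vanishing `k = ±1` circle coefficients of `ω_r`, the moment constraints on `a`, `b`, orthogonality in
`L²(Φ⁻¹)`, and the per-mode potential formula `∫ ω ψ_ω = −π ∫ ((B₁a) a + (B₁b) b) r + ∫ ω_r ψ_{ω_r}`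
(Gallay–Šverák, arXiv:2110.13739, §3, (Jk)/(Bkdef) for `k = 1`). [folklore] -/
theorem stub_arnoldModeSplit :
    ∀ (om : EuclideanSpace ℝ (Fin 2) → ℝ) (a b : ℝ → ℝ) (om₁ omr : EuclideanSpace ℝ (Fin 2) → ℝ),
    Continuous om →
    (∃ (C : ℝ) (N : ℕ), ∀ x, |om x| ≤ C * (1 + ‖x‖) ^ N * Real.exp (-(‖x‖ ^ 2 / 4))) →
    (∀ x, om (-x) = -om x) → ∫ x, x 0 * om x = 0 → ∫ x, x 1 * om x = 0 →
    (∀ r, a r = (1 / Real.pi) * ∫ θ in (-Real.pi)..Real.pi, om (circlePt r θ) * Real.cos θ) →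
    (∀ r, b r = (1 / Real.pi) * ∫ θ in (-Real.pi)..Real.pi, om (circlePt r θ) * Real.sin θ) →
    (∀ x, om₁ x = (a ‖x‖ * x 0 + b ‖x‖ * x 1) / ‖x‖) →
    (∀ x, omr x = om x - om₁ x) →
    ContinuousOn a (Set.Ici 0) ∧ ContinuousOn b (Set.Ici 0) ∧
    (∃ (C : ℝ) (N : ℕ), ∀ r : ℝ, 0 ≤ r →
      |a r| ≤ C * (1 + r) ^ N * Real.exp (-(r ^ 2 / 4)) ∧
      |b r| ≤ C * (1 + r) ^ N * Real.exp (-(r ^ 2 / 4))) ∧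
    Continuous omr ∧
    (∃ (C : ℝ) (N : ℕ), ∀ x, |omr x| ≤ C * (1 + ‖x‖) ^ N * Real.exp (-(‖x‖ ^ 2 / 4))) ∧
    (∀ x, omr (-x) = -omr x) ∧
    (∀ r : ℝ, 0 < r →
      ∫ θ in (-Real.pi)..Real.pi, omr (circlePt r θ) * Real.cos θ = 0 ∧
      ∫ θ in (-Real.pi)..Real.pi, omr (circlePt r θ) * Real.sin θ = 0) ∧
    ∫ r in Set.Ioi (0 : ℝ), r ^ 2 * a r = 0 ∧ ∫ r in Set.Ioi (0 : ℝ), r ^ 2 * b r = 0 ∧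
    ∫ x, (kerWeight ‖x‖)⁻¹ * om x ^ 2 =
      Real.pi * (∫ r in Set.Ioi (0 : ℝ), (kerWeight r)⁻¹ * (a r ^ 2 + b r ^ 2) * r) +
        ∫ x, (kerWeight ‖x‖)⁻¹ * omr x ^ 2 ∧
    ∫ x, om x * ∫ y, (2 * Real.pi)⁻¹ * Real.log ‖x - y‖ * om y =
      -(Real.pi * ∫ r in Set.Ioi (0 : ℝ),
          (((1 / 2 : ℝ) * ∫ s in Set.Ioi (0 : ℝ), min (r / s) (s / r) * a s * s) * a r +
            ((1 / 2 : ℝ) * ∫ s in Set.Ioi (0 : ℝ), min (r / s) (s / r) * b s * s) * b r) * r) +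
        ∫ x, omr x * ∫ y, (2 * Real.pi)⁻¹ * Real.log ‖x - y‖ * omr y := by
  intro om a b om₁ omr hom hgc hodd hm0 hm1 ha hb hom₁ homr
  obtain ⟨C, N, hC⟩ := hgc
  have hac : Continuous a := modeSplit_continuous_coeff hom Real.continuous_cos ha
  have hbc : Continuous b := modeSplit_continuous_coeff hom Real.continuous_sin hb
  have ha0 : a 0 = 0 := modeSplit_coeff_zero modeSplit_integral_cos ha
  have hb0 : b 0 = 0 := modeSplit_coeff_zero modeSplit_integral_sin hb
  have hom₁c : Continuous om₁ := modeSplit_continuous_om₁ hac hbc ha0 hb0 hom₁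
  have homrc : Continuous omr := modeSplit_continuous_omr hom hom₁c homr
  have hmom := modeSplit_moment_constraints hom ⟨C, N, hC⟩ hm0 hm1 ha hb
  exact ⟨hac.continuousOn, hbc.continuousOn, modeSplit_coeff_gaussClass ⟨C, N, hC⟩ ha hb, homrc,
    ⟨5 * C, N, modeSplit_omr_gaussClass hC ha hb hom₁ homr⟩, modeSplit_omr_odd hodd hom₁ homr,
    fun r hr => ⟨modeSplit_omr_circle_cos hom ha hom₁ homr hr, modeSplit_omr_circle_sin hom hb hom₁ homr hr⟩,
    hmom.1, hmom.2, modeSplit_weighted_sq_split hom ⟨C, N, hC⟩ ha hb hom₁ homr,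
    modeSplit_energy_split hom ⟨C, N, hC⟩ ha hb hom₁ homr⟩

end Summit.NavierStokesRegularity.NavierStokesRegularity.Theorems
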